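import Mathlib.RingTheory.Filtration
import Mathlib.RingTheory.Ideal.Quotient.Operations
import Mathlib.RingTheory.LocalRing.MaximalIdeal.Basic
import Mathlib.RingTheory.Finiteness.Quotient
import HarnessLib

/-!
# X11b, STEP L at `p ‖ N`: the Krull-intersection step of the ONE-SIDED congruence transfer
# (erratum to Castella 2018, proof of Thm. 1.1; Skinner 2016, p. 192) — pure commutative algebra

HONEST FRAMING (cell `bsd-stepL`, run/shared/lean/pub/bsd-stepL/, seat `bsd-stepL-bdp`, memo
`HOME/proof/PROOF-BDP.md` §5 Theorem B): STEP L (the lower bound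
`ord_p #Ш(E/K) ≥ 2·ord_p[E(K):ℤy_K] − Σ ord_p c_w`) at a multiplicative prime `p ‖ N` needs only
the Eisenstein-side divisibility `Ch_Λ(X_ac(E[p^∞]))Λ^{ur} ⊆ (L_p(f))` (H3). On the erratum's road
this divisibility for the weight-2 Steinberg form `f` is TRANSFERRED from the same divisibility for
congruent higher-weight crystalline forms `g_m ≡ f (mod p^m)`: from
`Fitt(X_f) + (p^m) = Fitt(X_{g_m}) + (p^m) ⊆ (L_p(g_m)) + (p^m) = (L_p(f)) + (p^m)` for all `m` one
concludes `Fitt(X_f) ⊆ (L_p(f))` by Krull's intersection theorem in the Noetherian local ring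
`Λ^{ur} = 𝒪^{ur}⟦T⟧`. THIS FILE proves exactly that abstract step (two theorems, no number theory):
nothing about Selmer groups, `p`-adic `L`-functions or the unrefereed input (FW21, Thm. 4.41) is
asserted here. No `sorry`, no new definition, no named fact.

References: [Castella2018Erratum] proof of Thm. 1.1 (p. 4: "(Fitt_{Λ_𝒪}(X^Σ_ac(E[p^∞])), p^m)Λ_𝒪^{ur}
= (L^Σ_p(f), p^m) … From this, the argument in [Ski16, p. 192] applies verbatim");
[Skinner2016PacificMC] §3.1, p. 192; Krull's intersection theorem (Mathlib
`Ideal.iInf_pow_smul_eq_bot_of_isLocalRing`).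
-/

namespace Summit.BirchSwinnertonDyer.Rank1Residual.X11b.CongruenceTransfer

variable {R : Type*} [CommRing R] [IsNoetherianRing R] [IsLocalRing R]

/-- **Krull-intersection transfer.** In a Noetherian local ring `R`, if an ideal `I` lies in
`J + 𝔞^m` for every `m`, for a proper ideal `𝔞`, then `I ≤ J`: the image of `I` in `R ⧸ J` lies in
`⋂_m 𝔞^m (R ⧸ J) = 0` (Krull). This is the step "`(Fitt(X), p^m) ⊆ (L, p^m)` for all `m` ⟹
`Fitt(X) ⊆ (L)`" of the congruence argument. [cite: Castella2018Erratum, proof of Thm. 1.1 (p. 4)]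
[cite: Skinner2016PacificMC, §3.1 (p. 192)] -/
theorem le_of_forall_le_sup_pow {𝔞 I J : Ideal R} (h𝔞 : 𝔞 ≠ ⊤)
    (h : ∀ m : ℕ, I ≤ J ⊔ 𝔞 ^ m) : I ≤ J := by
  intro x hx
  have key : Ideal.Quotient.mk J x ∈ (⨅ m : ℕ, 𝔞 ^ m • (⊤ : Submodule R (R ⧸ J))) := by
    rw [Submodule.mem_iInf]
    intro m
    obtain ⟨j, hj, y, hy, hjy⟩ := Submodule.mem_sup.mp (h m hx)
    have hmk : Ideal.Quotient.mk J x = y • (Ideal.Quotient.mk J 1) := by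
      rw [← hjy, map_add, Ideal.Quotient.eq_zero_iff_mem.mpr hj, zero_add, Algebra.smul_def,
        Ideal.Quotient.algebraMap_eq, map_one, mul_one]
    rw [hmk]
    exact Submodule.smul_mem_smul hy Submodule.mem_top
  have h0 : (⨅ m : ℕ, 𝔞 ^ m • (⊤ : Submodule R (R ⧸ J))) = ⊥ :=
    Ideal.iInf_pow_smul_eq_bot_of_isLocalRing (I := 𝔞) (M := R ⧸ J) h𝔞
  rw [h0, Submodule.mem_bot] at key
  exact Ideal.Quotient.eq_zero_iff_mem.mp key

/-- **The congruence transfer in the shape it is used** (`p ∈ 𝔪`, `L` the `p`-adic `L`-function,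
`I = Fitt_Λ(X_f)`): if `I + (p^m) ⊆ (L) + (p^m)` for every `m ≥ 1` then `I ⊆ (L)`. With
`Ch_Λ(X_f) = Fitt_Λ(X_f)` (no non-zero finite submodules) this is the divisibility
`Ch_Λ(X_ac(E[p^∞]))Λ^{ur} ⊆ (L_p(f))` of STEP L from the divisibilities for the congruent forms.
[cite: Castella2018Erratum, proof of Thm. 1.1 (p. 4)] [cite: Skinner2016PacificMC, §3.1 (p. 192)] -/
theorem le_span_singleton_of_forall_congruence {p L : R} (hp : p ∈ IsLocalRing.maximalIdeal R)
    {I : Ideal R}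
    (h : ∀ m : ℕ, 1 ≤ m → I ⊔ Ideal.span {p ^ m} ≤ Ideal.span {L} ⊔ Ideal.span {p ^ m}) :
    I ≤ Ideal.span {L} := by
  refine le_of_forall_le_sup_pow (𝔞 := Ideal.span {p}) ?_ fun m ↦ ?_
  · exact fun htop ↦ (IsLocalRing.mem_maximalIdeal p |>.mp hp) (Ideal.span_singleton_eq_top.mp htop)
  · rw [Ideal.span_singleton_pow]
    rcases Nat.eq_zero_or_pos m with rfl | hm
    · simp
    · exact le_sup_left.trans (h m hm)

end Summit.BirchSwinnertonDyer.Rank1Residual.X11b.CongruenceTransfer
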